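import Summits.AtomisticToContinuum.HydrodynamicLimit.Theorems.CollisionIsometryCLTCollisionalTransferLocalityDefs
import Literature.Analysis.FluidPDE.HardSphereFlowJointMeasurable
import Literature.Analysis.FunctionSpaces.TorusSpaceTime
import HarnessLib

/-!
# Block fields along hard-sphere orbits: formulas, bounds, measurability

Helper file (`--supports stmt-AtomisticToContinuum-9518`, line `hemisphere-affine-slaving`) for the
registered stub `stub_weightedKineticRelaxation` ([C]) of the crux `CollisionalTransferLocality`: the
measure-theoretic labour (M) of its proof, i.e. everything needed to know that the dominating
functions of the Cauchy–Schwarz glue are HONEST Bochner integrals. For the block fields of the line's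
vocabulary (`rhoB, mB, EB, uB, Dst, qfl`, file `…CollisionalTransferLocalityDefs`):
* finite-sum formulas (integration against the empirical measure `(N+1)⁻¹ Σ δ`);
* pointwise bounds: `|m̄|² ≤ 2ρ̄Ē` (weighted Cauchy–Schwarz), `|ū|² ≤ 2Ē/ρ̄`, `|ū| ≤ V`,
  `|D_jk| ≤ 8 Φ_b V²`, `|q| ≤ 4 Φ_b V³` when `0 ≤ φ ≤ Φ_b` and all speeds are `≤ V`;
* joint measurability of `(z, x) ↦ Σ D² + |q|²` (`measurable_kineticIntegrand`) and continuity of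
  `ρ̄, m̄, Ē` in `(z, x)`; `∫ₓ Ē = (N+1)⁻¹ E_kin` (translation invariance of Haar measure on `𝕋³`);
* along a GOOD orbit of a hard-sphere flow: measurability in time
  (`HardSphereFlow.measurable_flow_prod_torus`), energy conservation
  (`IsHardSphereTrajectory.configEnergy_eq_holds`), speeds `≤ √(2 E_kin)`; the bad set is null for
  the local Gibbs law; uniform bounds of test-field gradients on `[0, t] × 𝕋³`.
Sources: Spohn 1991 I §3; Cercignani–Illner–Pulvirenti 1994 §4.2 (flow); folklore measure theory.
-/

namespace Summit.AtomisticToContinuum.HydrodynamicLimit.Theorems.HemisphereAffineSlaving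

open scoped BigOperators Topology Classical MeasureTheory ENNReal
open Filter Set Function TopologicalSpace MeasureTheory

noncomputable section

open Literature.MathematicalPhysics.KineticTheory (T3 V3 localGibbsLaw hsDiameter)
open Literature.Analysis.FluidPDE (empiricalMeasure empiricalMeasure_eq integral_empiricalMeasure
  configEnergy HardSphereFlow Config)

/-! ## Finite-sum formulas and pointwise bounds -/

variable {N : ℕ}

/-- Integration of a vector-valued function against the empirical measure of `N + 1` particles is a
normalised finite sum. [folklore] -/
theorem integral_empiricalMeasure_vec {E : Type*} [NormedAddCommGroup E] [NormedSpace ℝ E]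
    [CompleteSpace E] (w : Cfg N) (f : T3 × V3 → E) :
    ∫ y, f y ∂(empiricalMeasure w) = ((N + 1 : ℕ) : ℝ)⁻¹ • ∑ i, f (w i) := by
  rw [empiricalMeasure_eq, integral_smul_measure, integral_finsetSum_measure]
  · simp only [integral_dirac, ENNReal.toReal_inv, ENNReal.toReal_natCast]
  · exact fun i _ => integrable_dirac (by simp)

/-- `ρ̄ = (N+1)⁻¹ Σᵢ φ(xᵢ − x)`. [folklore] -/
theorem rhoB_eq (φ : ℕ → T3 → ℝ) (w : Cfg N) (x : T3) :
    rhoB φ N w x = ((N + 1 : ℕ) : ℝ)⁻¹ * ∑ i, φ N ((w i).1 - x) :=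
  integral_empiricalMeasure _ _

/-- `Ē = (N+1)⁻¹ Σᵢ φ(xᵢ − x) |vᵢ|²/2`. [folklore] -/
theorem EB_eq (φ : ℕ → T3 → ℝ) (w : Cfg N) (x : T3) :
    EB φ N w x = ((N + 1 : ℕ) : ℝ)⁻¹ * ∑ i, φ N ((w i).1 - x) * (‖(w i).2‖ ^ 2 / 2) :=
  integral_empiricalMeasure _ _

/-- `m̄ = (N+1)⁻¹ Σᵢ φ(xᵢ − x) vᵢ`. [folklore] -/
theorem mB_eq (φ : ℕ → T3 → ℝ) (w : Cfg N) (x : T3) :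
    mB φ N w x = ((N + 1 : ℕ) : ℝ)⁻¹ • ∑ i, φ N ((w i).1 - x) • (w i).2 :=
  integral_empiricalMeasure_vec _ _

/-- `q = (N+1)⁻¹ Σᵢ (φᵢ |vᵢ − ū|²/2) (vᵢ − ū)`. [folklore] -/
theorem qfl_eq (φ : ℕ → T3 → ℝ) (w : Cfg N) (x : T3) :
    qfl φ N w x = ((N + 1 : ℕ) : ℝ)⁻¹ •
      ∑ i, (φ N ((w i).1 - x) * ‖(w i).2 - uB φ N w x‖ ^ 2 / 2) • ((w i).2 - uB φ N w x) :=
  integral_empiricalMeasure_vec _ _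

/-- `D_jk` as a finite sum. [folklore] -/
theorem Dst_eq (φ : ℕ → T3 → ℝ) (w : Cfg N) (x : T3) (j k : Fin 3) :
    Dst φ N w x j k = ((N + 1 : ℕ) : ℝ)⁻¹ * ∑ i, φ N ((w i).1 - x) *
        (((w i).2 j - uB φ N w x j) * ((w i).2 k - uB φ N w x k)) -
      (if j = k then (∑ l : Fin 3, ((N + 1 : ℕ) : ℝ)⁻¹ *
        ∑ i, φ N ((w i).1 - x) * ((w i).2 l - uB φ N w x l) ^ 2) / 3 else 0) := by
  simp only [Dst, integral_empiricalMeasure]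

section Bounds

variable {φ : ℕ → T3 → ℝ} {w : Cfg N} {x : T3} {Φb Vb : ℝ}

/-- `0 ≤ ρ̄` for a nonnegative kernel. [folklore] -/
theorem rhoB_nonneg (hφ0 : ∀ y, 0 ≤ φ N y) : 0 ≤ rhoB φ N w x := by
  rw [rhoB_eq]; exact mul_nonneg (by positivity) (Finset.sum_nonneg fun i _ => hφ0 _)

/-- `0 ≤ Ē` for a nonnegative kernel. [folklore] -/
theorem EB_nonneg (hφ0 : ∀ y, 0 ≤ φ N y) : 0 ≤ EB φ N w x := by
  rw [EB_eq]
  exact mul_nonneg (by positivity) (Finset.sum_nonneg fun i _ => mul_nonneg (hφ0 _) (by positivity))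

/-- Weighted Cauchy–Schwarz: `|m̄|² ≤ 2 ρ̄ Ē`. [folklore] -/
theorem norm_mB_sq_le (hφ0 : ∀ y, 0 ≤ φ N y) :
    ‖mB φ N w x‖ ^ 2 ≤ 2 * rhoB φ N w x * EB φ N w x := by
  rw [mB_eq, rhoB_eq, EB_eq, norm_smul, mul_pow, Real.norm_eq_abs, abs_of_nonneg (by positivity)]
  set c : ℝ := ((N + 1 : ℕ) : ℝ)⁻¹
  set a : Fin (N + 1) → ℝ := fun i => φ N ((w i).1 - x)
  have ha : ∀ i, 0 ≤ a i := fun i => hφ0 _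
  have h1 : ‖∑ i, a i • (w i).2‖ ≤ ∑ i, Real.sqrt (a i) * (Real.sqrt (a i) * ‖(w i).2‖) := by
    refine (norm_sum_le _ _).trans (le_of_eq (Finset.sum_congr rfl fun i _ => ?_))
    rw [norm_smul, Real.norm_eq_abs, abs_of_nonneg (ha i), ← mul_assoc, Real.mul_self_sqrt (ha i)]
  have h2 := Finset.sum_mul_sq_le_sq_mul_sq Finset.univ (fun i => Real.sqrt (a i))
    (fun i => Real.sqrt (a i) * ‖(w i).2‖)
  simp only [mul_pow, Real.sq_sqrt (ha _)] at h2
  have h3 : ‖∑ i, a i • (w i).2‖ ^ 2 ≤ (∑ i, a i) * ∑ i, a i * ‖(w i).2‖ ^ 2 :=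
    (pow_le_pow_left₀ (norm_nonneg _) h1 2).trans h2
  have h4 : ∑ i, a i * (‖(w i).2‖ ^ 2 / 2) = (∑ i, a i * ‖(w i).2‖ ^ 2) / 2 := by
    rw [Finset.sum_div]; exact Finset.sum_congr rfl fun i _ => by ring
  rw [h4]
  have hc : 0 ≤ c := by positivity
  nlinarith [mul_le_mul_of_nonneg_left h3 (mul_nonneg hc hc)]

/-- On a block with `ρ̄ > 0`: `|ū|² ≤ 2Ē/ρ̄`. [folklore] -/
theorem norm_uB_sq_le (hφ0 : ∀ y, 0 ≤ φ N y) (hρ : 0 < rhoB φ N w x) :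
    ‖uB φ N w x‖ ^ 2 ≤ 2 * EB φ N w x / rhoB φ N w x := by
  have h := norm_mB_sq_le (w := w) (x := x) hφ0
  rw [uB, norm_smul, mul_pow, Real.norm_eq_abs, abs_inv, abs_of_pos hρ, le_div_iff₀ hρ]
  calc (rhoB φ N w x)⁻¹ ^ 2 * ‖mB φ N w x‖ ^ 2 * rhoB φ N w x
      ≤ (rhoB φ N w x)⁻¹ ^ 2 * (2 * rhoB φ N w x * EB φ N w x) * rhoB φ N w x := by gcongr
    _ = 2 * EB φ N w x := by field_simp

/-- `|m̄| ≤ V ρ̄` when all speeds are `≤ V`. [folklore] -/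
theorem norm_mB_le (hφ0 : ∀ y, 0 ≤ φ N y) (hV : ∀ i, ‖(w i).2‖ ≤ Vb) :
    ‖mB φ N w x‖ ≤ Vb * rhoB φ N w x := by
  rw [mB_eq, rhoB_eq, norm_smul, Real.norm_eq_abs, abs_of_nonneg (by positivity), mul_left_comm,
    Finset.mul_sum]
  refine mul_le_mul_of_nonneg_left ((norm_sum_le _ _).trans (Finset.sum_le_sum fun i _ => ?_))
    (by positivity)
  rw [norm_smul, Real.norm_eq_abs, abs_of_nonneg (hφ0 _), mul_comm]
  exact mul_le_mul_of_nonneg_right (hV i) (hφ0 _)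

/-- `|ū| ≤ V` when all speeds are `≤ V` (`ū` is a convex combination, or junk `0`). [folklore] -/
theorem norm_uB_le (hφ0 : ∀ y, 0 ≤ φ N y) (hVb : 0 ≤ Vb) (hV : ∀ i, ‖(w i).2‖ ≤ Vb) :
    ‖uB φ N w x‖ ≤ Vb := by
  have hρ := rhoB_nonneg (w := w) (x := x) hφ0
  rw [uB, norm_smul, Real.norm_eq_abs, abs_inv, abs_of_nonneg hρ]
  rcases hρ.lt_or_eq with hρ' | hρ'
  · rw [inv_mul_le_iff₀ hρ', mul_comm]; exact norm_mB_le hφ0 hV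
  · rw [← hρ', inv_zero, zero_mul]; exact hVb

/-- `|vᵢ − ū| ≤ 2V`. [folklore] -/
theorem norm_vel_sub_uB_le (hφ0 : ∀ y, 0 ≤ φ N y) (hVb : 0 ≤ Vb) (hV : ∀ i, ‖(w i).2‖ ≤ Vb)
    (i : Fin (N + 1)) : ‖(w i).2 - uB φ N w x‖ ≤ 2 * Vb :=
  (norm_sub_le _ _).trans (by linarith [hV i, norm_uB_le (w := w) (x := x) hφ0 hVb hV])

/-- `|D_jk| ≤ 8 Φ_b V²` when `0 ≤ φ ≤ Φ_b` and all speeds are `≤ V`. [folklore] -/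
theorem abs_Dst_le (hφ0 : ∀ y, 0 ≤ φ N y) (hφb : ∀ y, φ N y ≤ Φb) (hVb : 0 ≤ Vb)
    (hV : ∀ i, ‖(w i).2‖ ≤ Vb) (j k : Fin 3) : |Dst φ N w x j k| ≤ 8 * Φb * Vb ^ 2 := by
  have hΦb : 0 ≤ Φb := (hφ0 0).trans (hφb 0)
  have hc0 : 0 ≤ ((N + 1 : ℕ) : ℝ)⁻¹ := by positivity
  have hcomp : ∀ i l, |(w i).2 l - uB φ N w x l| ≤ 2 * Vb := fun i l => by
    rw [← PiLp.sub_apply, ← Real.norm_eq_abs]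
    exact (PiLp.norm_apply_le _ l).trans (norm_vel_sub_uB_le hφ0 hVb hV i)
  have hterm : ∀ i l l', |φ N ((w i).1 - x) * (((w i).2 l - uB φ N w x l) *
      ((w i).2 l' - uB φ N w x l'))| ≤ Φb * (2 * Vb) ^ 2 := fun i l l' => by
    rw [abs_mul, abs_mul, abs_of_nonneg (hφ0 _), sq]
    exact mul_le_mul (hφb _) (mul_le_mul (hcomp i l) (hcomp i l') (abs_nonneg _) (by positivity))
      (by positivity) hΦb
  have hsum : ∀ l l', |((N + 1 : ℕ) : ℝ)⁻¹ * ∑ i, φ N ((w i).1 - x) *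
      (((w i).2 l - uB φ N w x l) * ((w i).2 l' - uB φ N w x l'))| ≤ Φb * (2 * Vb) ^ 2 := by
    intro l l'
    rw [abs_mul, abs_of_nonneg hc0]
    calc ((N + 1 : ℕ) : ℝ)⁻¹ * |∑ i, φ N ((w i).1 - x) *
          (((w i).2 l - uB φ N w x l) * ((w i).2 l' - uB φ N w x l'))|
        ≤ ((N + 1 : ℕ) : ℝ)⁻¹ * ∑ _i : Fin (N + 1), Φb * (2 * Vb) ^ 2 :=
          mul_le_mul_of_nonneg_left ((Finset.abs_sum_le_sum_abs _ _).trans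
            (Finset.sum_le_sum fun i _ => hterm i l l')) hc0
      _ = Φb * (2 * Vb) ^ 2 := by
          rw [Finset.sum_const, Finset.card_univ, Fintype.card_fin, nsmul_eq_mul, ← mul_assoc,
            inv_mul_cancel₀ (by positivity), one_mul]
  rw [Dst_eq]
  refine (abs_sub _ _).trans ?_
  have hdiag : |(if j = k then (∑ l : Fin 3, ((N + 1 : ℕ) : ℝ)⁻¹ *
      ∑ i, φ N ((w i).1 - x) * ((w i).2 l - uB φ N w x l) ^ 2) / 3 else 0)| ≤
      Φb * (2 * Vb) ^ 2 := by
    split_ifs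
    · rw [abs_div, abs_of_pos (by norm_num : (0 : ℝ) < 3), div_le_iff₀ (by norm_num : (0 : ℝ) < 3)]
      refine (Finset.abs_sum_le_sum_abs _ _).trans ?_
      calc ∑ l : Fin 3, |((N + 1 : ℕ) : ℝ)⁻¹ * ∑ i, φ N ((w i).1 - x) *
            ((w i).2 l - uB φ N w x l) ^ 2| ≤ ∑ _l : Fin 3, Φb * (2 * Vb) ^ 2 :=
            Finset.sum_le_sum fun l _ => by simpa only [sq] using hsum l l
        _ = Φb * (2 * Vb) ^ 2 * 3 := by simp [Finset.sum_const]; ring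
    · rw [abs_zero]; positivity
  nlinarith [hsum j k, hdiag]

/-- `|q| ≤ 4 Φ_b V³` when `0 ≤ φ ≤ Φ_b` and all speeds are `≤ V`. [folklore] -/
theorem norm_qfl_le (hφ0 : ∀ y, 0 ≤ φ N y) (hφb : ∀ y, φ N y ≤ Φb) (hVb : 0 ≤ Vb)
    (hV : ∀ i, ‖(w i).2‖ ≤ Vb) : ‖qfl φ N w x‖ ≤ 4 * Φb * Vb ^ 3 := by
  have hΦb : 0 ≤ Φb := (hφ0 0).trans (hφb 0)
  have hc0 : 0 ≤ ((N + 1 : ℕ) : ℝ)⁻¹ := by positivity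
  rw [qfl_eq, norm_smul, Real.norm_eq_abs, abs_of_nonneg hc0]
  calc ((N + 1 : ℕ) : ℝ)⁻¹ * ‖∑ i, (φ N ((w i).1 - x) * ‖(w i).2 - uB φ N w x‖ ^ 2 / 2) •
        ((w i).2 - uB φ N w x)‖
      ≤ ((N + 1 : ℕ) : ℝ)⁻¹ * ∑ _i : Fin (N + 1), Φb * (2 * Vb) ^ 3 / 2 := by
        refine mul_le_mul_of_nonneg_left ((norm_sum_le _ _).trans
          (Finset.sum_le_sum fun i _ => ?_)) hc0
        have hd := norm_vel_sub_uB_le (w := w) (x := x) hφ0 hVb hV i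
        rw [norm_smul, Real.norm_eq_abs,
          abs_of_nonneg (div_nonneg (mul_nonneg (hφ0 _) (sq_nonneg _)) zero_le_two)]
        calc φ N ((w i).1 - x) * ‖(w i).2 - uB φ N w x‖ ^ 2 / 2 * ‖(w i).2 - uB φ N w x‖
            = φ N ((w i).1 - x) * ‖(w i).2 - uB φ N w x‖ ^ 3 / 2 := by ring
          _ ≤ Φb * (2 * Vb) ^ 3 / 2 :=
            div_le_div_of_nonneg_right (mul_le_mul (hφb _)
              (pow_le_pow_left₀ (norm_nonneg _) hd 3) (by positivity) hΦb) zero_le_two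
    _ = Φb * (2 * Vb) ^ 3 / 2 := by
        rw [Finset.sum_const, Finset.card_univ, Fintype.card_fin, nsmul_eq_mul, ← mul_assoc,
          inv_mul_cancel₀ (by positivity), one_mul]
    _ = 4 * Φb * Vb ^ 3 := by ring

/-- Uniform bound on the kinetic integrand `Σ D² + |q|²` of `FMRAt` along configurations with
bounded speeds. [folklore] -/
theorem kineticIntegrand_le (hφ0 : ∀ y, 0 ≤ φ N y) (hφb : ∀ y, φ N y ≤ Φb) (hVb : 0 ≤ Vb)
    (hV : ∀ i, ‖(w i).2‖ ≤ Vb) :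
    (∑ j, ∑ k, Dst φ N w x j k ^ 2) + ‖qfl φ N w x‖ ^ 2 ≤
      9 * (8 * Φb * Vb ^ 2) ^ 2 + (4 * Φb * Vb ^ 3) ^ 2 := by
  have hD : ∀ j k, Dst φ N w x j k ^ 2 ≤ (8 * Φb * Vb ^ 2) ^ 2 := fun j k =>
    sq_le_sq' (abs_le.1 (abs_Dst_le hφ0 hφb hVb hV j k)).1 (abs_le.1 (abs_Dst_le hφ0 hφb hVb hV j k)).2
  have hq : ‖qfl φ N w x‖ ^ 2 ≤ (4 * Φb * Vb ^ 3) ^ 2 :=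
    pow_le_pow_left₀ (norm_nonneg _) (norm_qfl_le hφ0 hφb hVb hV) 2
  refine add_le_add ((Finset.sum_le_sum fun j _ => Finset.sum_le_sum fun k _ => hD j k).trans ?_) hq
  simp only [Finset.sum_const, Finset.card_univ, Fintype.card_fin]
  exact le_of_eq (by ring)

end Bounds

/-- Elementary: `|a| ≤ ε + y/ε` whenever `a² ≤ y`, `ε > 0`. [folklore] -/
theorem abs_le_eps {ε a y : ℝ} (hε : 0 < ε) (hy : a ^ 2 ≤ y) : |a| ≤ ε + y / ε := by
  have key : |a| * ε ≤ ε ^ 2 + y := by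
    nlinarith [sq_nonneg (ε - |a| / 2), sq_abs a, abs_nonneg a]
  rw [add_div' y ε ε hε.ne', le_div_iff₀ hε]
  nlinarith [key]

/-- Elementary: `|a| |b| ≤ y/ε + ε b²` whenever `a² ≤ y`, `ε > 0`. [folklore] -/
theorem abs_mul_abs_le_eps {ε a b y : ℝ} (hε : 0 < ε) (hy : a ^ 2 ≤ y) :
    |a| * |b| ≤ y / ε + ε * b ^ 2 := by
  have key : |a| * |b| * ε ≤ y + ε ^ 2 * b ^ 2 := by
    nlinarith [sq_nonneg (|a| - ε * |b|), sq_abs a, sq_abs b, abs_nonneg a, abs_nonneg b,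
      mul_nonneg (abs_nonneg a) (abs_nonneg b)]
  rw [div_add' y (ε * b ^ 2) ε hε.ne', le_div_iff₀ hε]
  nlinarith [key]

section Measurability

variable {φ : ℕ → T3 → ℝ}

/-- `(z, x) ↦ ρ̄` is continuous. [folklore] -/
theorem continuous_rhoB (hφc : Continuous (φ N)) : Continuous fun p : Cfg N × T3 => rhoB φ N p.1 p.2 := by
  simp only [rhoB_eq]; fun_prop

/-- `(z, x) ↦ Ē` is continuous. [folklore] -/
theorem continuous_EB (hφc : Continuous (φ N)) : Continuous fun p : Cfg N × T3 => EB φ N p.1 p.2 := by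
  simp only [EB_eq]; fun_prop

/-- `(z, x) ↦ m̄` is continuous. [folklore] -/
theorem continuous_mB (hφc : Continuous (φ N)) : Continuous fun p : Cfg N × T3 => mB φ N p.1 p.2 := by
  simp only [mB_eq]; fun_prop

/-- `(z, x) ↦ ū` is measurable. [folklore] -/
theorem measurable_uB (hφc : Continuous (φ N)) : Measurable fun p : Cfg N × T3 => uB φ N p.1 p.2 := by
  haveI : ∀ i : Fin (N + 1), BorelSpace (T3 × V3) := fun _ => Prod.borelSpace
  exact ((continuous_rhoB hφc).measurable.inv).smul (continuous_mB hφc).measurable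

/-- **Measurability of the kinetic integrand in `(z, x)`** (helper stub of
`stub_weightedKineticRelaxation`, crux stmt-AtomisticToContinuum-9518, line hemisphere-affine-slaving):
for a continuous kernel, `(z, x) ↦ Σ_jk D_jk(z, x)² + |q(z, x)|²` is measurable on phase space × torus
(block fields are finite sums of products of continuous functions and the measurable junk-guarded
inverse `ρ̄⁻¹`). [folklore] -/
theorem measurable_kineticIntegrand : ∀ (φ : ℕ → T3 → ℝ) (N : ℕ), Continuous (φ N) →
    Measurable fun p : Cfg N × T3 =>
      (∑ j, ∑ k, Dst φ N p.1 p.2 j k ^ 2) + ‖qfl φ N p.1 p.2‖ ^ 2 := by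
  intro φ N hφc
  haveI : ∀ i : Fin (N + 1), BorelSpace (T3 × V3) := fun _ => Prod.borelSpace
  have hU := measurable_uB (N := N) hφc
  have hD : ∀ j k, Measurable fun p : Cfg N × T3 => Dst φ N p.1 p.2 j k := by
    intro j k
    simp only [Dst_eq]
    generalize uB φ N = u at hU ⊢
    by_cases hjk : j = k
    · simp only [hjk, if_true]; fun_prop
    · simp only [hjk, if_false, sub_zero]; fun_prop
  have hq : Measurable fun p : Cfg N × T3 => qfl φ N p.1 p.2 := by
    simp only [qfl_eq]
    generalize uB φ N = u at hU ⊢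
    fun_prop
  exact (Finset.measurable_sum _ fun j _ => Finset.measurable_sum _ fun k _ =>
    (hD j k).pow_const 2).add (hq.norm.pow_const 2)

end Measurability

/-- `∫ₓ Ē(z, x) dx = (N+1)⁻¹ × (kinetic energy of z)` for a kernel of mass one. [folklore] -/
theorem integral_EB {φ : ℕ → T3 → ℝ} (hφc : Continuous (φ N)) (hφ1 : ∫ y, φ N y = 1) (w : Cfg N) :
    ∫ x, EB φ N w x = ((N + 1 : ℕ) : ℝ)⁻¹ * configEnergy w := by
  haveI : (volume : Measure T3).IsNegInvariant := Measure.IsAddHaarMeasure.isNegInvariant_of_regular _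
  have hint : ∀ i, Integrable (fun x : T3 => φ N ((w i).1 - x)) := fun i =>
    hφc.integrable_unitAddTorus.comp_sub_left (w i).1
  simp only [EB_eq]
  rw [integral_const_mul, integral_finsetSum _ fun i _ => (hint i).mul_const _]
  simp_rw [integral_mul_const, integral_sub_left_eq_self (φ N) volume, hφ1, one_mul]
  simp only [configEnergy, Finset.mul_sum]
  exact Finset.sum_congr rfl fun i _ => by ring

/-- The bad set of a hard-sphere flow is null for the local Gibbs law (re-proved from
`FrequencyLawReduction.localGibbsLaw_compl_good`). [folklore] -/
theorem localGibbsLaw_compl_good' {σ : ℝ} {a₀ θ₀ : T3 → ℝ} {u₀ : T3 → V3}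
    (Φ : HardSphereFlow (Literature.Analysis.FluidPDE.Torus.geometry (Fin 3)) (hsDiameter σ N) (N + 1)) :
    localGibbsLaw σ a₀ u₀ θ₀ N Φ Φ.goodᶜ = 0 := by
  unfold localGibbsLaw Literature.Analysis.FluidPDE.particleLaw
  exact withDensity_absolutelyContinuous _ _ Φ.measure_compl_good

section Orbit

variable {σ : ℝ} (Φ : Flows σ) {z : Cfg N} (hz : z ∈ (Φ N).good)
include hz

/-- The orbit of a good point is measurable in time. [folklore] -/
theorem measurable_orbit : Measurable fun s : ℝ => (Φ N).flow s z :=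
  (HardSphereFlow.measurable_flow_prod_torus (Φ N)).comp
    (measurable_const.prodMk measurable_id : Measurable fun s : ℝ => ((⟨z, hz⟩ : (Φ N).good), s))

/-- Energy conservation along a good orbit. [folklore] -/
theorem configEnergy_orbit (s : ℝ) : configEnergy ((Φ N).flow s z) = configEnergy z := by
  have h := Literature.Analysis.FluidPDE.IsHardSphereTrajectory.configEnergy_eq_holds
    ((Φ N).isTrajectory z hz) s 0
  simpa [(Φ N).flow_zero z hz] using h

/-- Speeds along a good orbit are bounded by `√(2 × energy)`. [folklore] -/
theorem norm_vel_orbit_le (s : ℝ) (i : Fin (N + 1)) :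
    ‖((Φ N).flow s z i).2‖ ≤ Real.sqrt (2 * configEnergy z) := by
  rw [← configEnergy_orbit Φ hz s, ← abs_norm]
  apply Real.abs_le_sqrt
  rw [configEnergy, ← mul_assoc, mul_inv_cancel₀ two_ne_zero, one_mul]
  exact Finset.single_le_sum (f := fun j => ‖((Φ N).flow s z j).2‖ ^ 2) (fun j _ => sq_nonneg _)
    (Finset.mem_univ i)

end Orbit

/-- Uniform bounds on the test-field gradients on `[0, t] × 𝕋³`. [folklore] -/
theorem exists_grad_bound {t : ℝ} (ht : 0 < t) {ψ : ℝ → T3 → V3} {χ : ℝ → T3 → ℝ}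
    (hψ : Literature.Analysis.FunctionSpaces.Torus.IsSmoothSpaceTimeOn (Icc 0 t) ψ)
    (hχ : Literature.Analysis.FunctionSpaces.Torus.IsSmoothSpaceTimeOn (Icc 0 t) χ) :
    ∃ C : ℝ, 0 ≤ C ∧ (∀ s ∈ Icc 0 t, ∀ x a b, |gradPsi ψ s x a b| ≤ C) ∧
      (∀ s ∈ Icc 0 t, ∀ x a, |gradChi χ s x a| ≤ C) := by
  have hU : UniqueDiffOn ℝ (Icc (0 : ℝ) t) := uniqueDiffOn_Icc ht
  have hψa : ∀ a : Fin 3, ∃ C, ∀ s ∈ Icc 0 t, ∀ x,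
      ‖Literature.Analysis.FunctionSpaces.Torus.gradient (fun y => ψ s y a) x‖ ≤ C := fun a =>
    ((hψ.apply a).gradient hU).exists_norm_le_of_isCompact isCompact_Icc Subset.rfl
  choose Cψ hCψ using hψa
  obtain ⟨Cχ, hCχ⟩ := (hχ.gradient hU).exists_norm_le_of_isCompact isCompact_Icc Subset.rfl
  refine ⟨(∑ a, |Cψ a|) + |Cχ|, by positivity, fun s hs x a b => ?_, fun s hs x a => ?_⟩
  · calc |gradPsi ψ s x a b|
        ≤ ‖Literature.Analysis.FunctionSpaces.Torus.gradient (fun y => ψ s y a) x‖ := by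
          rw [← Real.norm_eq_abs]; exact PiLp.norm_apply_le _ b
      _ ≤ |Cψ a| := (hCψ a s hs x).trans (le_abs_self _)
      _ ≤ ∑ a, |Cψ a| := Finset.single_le_sum (f := fun a => |Cψ a|) (fun a _ => abs_nonneg _)
          (Finset.mem_univ a)
      _ ≤ _ := le_add_of_nonneg_right (abs_nonneg _)
  · calc |gradChi χ s x a| ≤ ‖Literature.Analysis.FunctionSpaces.Torus.gradient (χ s) x‖ := by
          rw [← Real.norm_eq_abs]; exact PiLp.norm_apply_le _ a
      _ ≤ |Cχ| := (hCχ s hs x).trans (le_abs_self _)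
      _ ≤ _ := le_add_of_nonneg_left (by positivity)

/-- `v_b² ≤ |v|²` for `v ∈ ℝ³`. [folklore] -/
theorem sq_apply_le_norm_sq (v : V3) (b : Fin 3) : v b ^ 2 ≤ ‖v‖ ^ 2 := by
  rw [← sq_abs, ← Real.norm_eq_abs]
  exact pow_le_pow_left₀ (norm_nonneg _) (PiLp.norm_apply_le _ b) 2

/-- Union bound over three bad events off a null set. [folklore] -/
theorem measure_le_of_imp3 {Ω : Type*} [MeasurableSpace Ω] (P : Measure Ω) {G B W E F : Set Ω}
    (hG : P Gᶜ = 0) (h : ∀ z ∈ B, z ∈ G → z ∉ W → z ∉ E → z ∈ F) :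
    P B ≤ P W + (P E + P F) := by
  calc P B ≤ P (Gᶜ ∪ (W ∪ (E ∪ F))) := measure_mono fun z hz => by
        by_cases hzG : z ∈ G
        · by_cases hW : z ∈ W
          · exact Or.inr (Or.inl hW)
          by_cases hE : z ∈ E
          · exact Or.inr (Or.inr (Or.inl hE))
          exact Or.inr (Or.inr (Or.inr (h z hz hzG hW hE)))
        · exact Or.inl hzG
    _ ≤ P Gᶜ + (P W + (P E + P F)) := (measure_union_le _ _).trans
        (add_le_add le_rfl ((measure_union_le _ _).trans (add_le_add le_rfl (measure_union_le _ _))))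
    _ = P W + (P E + P F) := by rw [hG, zero_add]

end

end Summit.AtomisticToContinuum.HydrodynamicLimit.Theorems.HemisphereAffineSlaving
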